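import Summits.HodgeConjecture.HodgeConjecture.Theorems.F0P6aPELWitnessEDefs   -- ★ p850070 twin of ED. 5 474c236ce4eebf25 (namespace KEPT ⇒ every FQN unchanged)
import HarnessLib

/-! # F0_P6a_PELWitnessEDefs — ED. 6 = SHIM (rung-0 re-home; LEAD «M-72» (4) ∕ «M-78» CLASS III, «K3» sweep; dealer «L7» LA7-plan (g4))

Every declaration of ED. 5 (sha16 474c236ce4eebf25, 415 l., sorry-free: `GSAdele`, `IsCMTypeThrough`, `mOf`, `AuxChartGS`,
`PELWitnessE`, `SigDatum`, `RecordSignatureDatumOfSystem` — structures with all their fields and projections) now lives, byte for byte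
and under the SAME namespace `Summit.HodgeConjecture.HodgeConjecture.Cruxes.HLiu418.F0P6aPELWitnessE`, in
★ `Theorems/F0P6aPELWitnessEDefs.lean` (p850070; RE-HOME TABLE v1.3.1 row 20).  This module keeps its name so that its importers
(`rg` 09:0xZ: `F0_P6a_SigmaGAL`, `F0_P6a_StubSIG`, `F0_P6a_ChartFramePin`, `F0_P6a_PELWitnessE`, `F0_P6a_StubUNIVFAM`) and by-name
readers resolve unchanged through the import above; it declares nothing.  ORDER NOTE: this shim must be in the tree no later than the
`F0_P6a_ChartFramePin` shim (whose ★ twin imports ★ `Theorems.F0P6aPELWitnessEDefs`), else an importer of both editions would hold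
the (D) declarations twice.  Edition history ED. 1–5 stays in the line card and in git; future changes are ★-side proposals on the
`Theorems/` file.  HC_CM is proved only modulo the 7 printed citations (2 remaining named inputs: hLiu418 = stmt-HodgeConjecture-24832,
h413 = stmt-HodgeConjecture-24833) until rung 0 closes; count-neutral (0 `sorry`, 0 socket, 0 declaration). -/
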